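import Summits.Ventures.YMGap.Census.TwistCensusStructure
import HarnessLib

/-!
# Venture YMGap, track (b) census — the VANISHING HALF of the germ law (G) as a theorem, and the reduction of its
# coefficient half to one Haar-moment identity

HONEST FRAMING: venture file of the cell `pub-ymgap` (QuantumFields programme), track (b).  Exact statements about the
one-character census polynomials of `Census/TwistCensusObjects.lean` on a rectangular torus `L₀ × ⋯ × L_{d−1}` (any `d`);
no sign of any Haar moment is decided here, nothing about root locations, limits or physics.

Mechanism N-3 (i) of HOME/STRUCTURE.md §4, made a theorem.  Fix a plane `(i, j)`, `i < j`, and the twist stack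
`𝒱_{ij} = rectVortexSheet Ls i j` (the `(i, j)`-plaquettes at transverse position `(x_i, x_j) = (0, 0)`).  Write
`stackAt a b` for the parallel stack at `(x_i, x_j) = (a, b)` and `P := L_i L_j`.
* `rectCoboundary_jLinksAt` / `rectCoboundary_iLinksAt`: adjacent parallel stacks cobound a link set
  (`δ(j-links at (a+1, b)) = stackAt a b ∆ stackAt (a+1) b`, and the same in the `j` direction) — port of
  `Census/TwistSheet.coboundary_sheetLinksAt` to the rectangular torus, plus the second direction;
* `odd_inter_stackAt_iff` : if `I(S) ≠ 0` then `|S ∩ stackAt a b|` has the SAME parity for all `(a, b)` (support rule);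
* `rectCharMoment_eq_zero_of_card_lt_of_odd` : **if `|S| < L_i L_j` and `|S ∩ 𝒱_{ij}|` is odd then `I(S) = 0`** — a
  contributing `S` meeting the stack oddly meets all `L_i L_j` disjoint parallel stacks, hence has `≥ L_i L_j` plaquettes;
* `twistCensusPoly_coeff_eq_zero_of_lt` : **`coeff_k N_{ij} = 0` for every `k + 1 < L_i L_j`** — the first conjunct of
  `Conjectures.TwistCensusParity.GermLaw`, now a THEOREM for every rectangular torus (via `N = D′Z − DZ′`,
  `D := Z⁻ − Z`, `X^{P} ∣ D`);
* `twistCensusPoly_coeff_germ` : `coeff_{P−1} N_{ij} = −2·P·sheetMomentSum`, where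
  `sheetMomentSum Ls i j := Σ_{|S| = P, |S ∩ 𝒱_{ij}| odd} 2^{P} I(S)` — so the second conjunct of the germ law (G)
  («`coeff_{P−1} N = −2·P·L_ρ`») is EQUIVALENT to the single Haar-moment identity `sheetMomentSum = L_ρ` (mechanism: the
  contributing `S` are exactly the `L_ρ` flat sheets, each with `2^P I(sheet) = 1`; that identification and that integral
  are NOT proved here).

References: E. T. Tomboulis, arXiv:0707.2179 §4 (after (4.1)), §6 (6.2)–(6.4) [cite: Tomboulis2007Confinement, §6 eqs. (6.2)–(6.4)];
HOME/STRUCTURE.md §4 N-3; HOME/engine/census/TwistCensusParity/ (evidence: (G) 127/127 rows).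
-/

noncomputable section

open MeasureTheory Finset Real Polynomial
open scoped BigOperators symmDiff
open Literature.MathematicalPhysics.QuantumLattice
open Literature.MathematicalPhysics.QuantumFieldTheory
open Literature.MathematicalPhysics.QuantumFieldTheory.Tomboulis2007

namespace Summit.Ventures.YMGap.Census

variable {d : ℕ} (Ls : Fin d → ℕ) [∀ i, NeZero (Ls i)]

/-- The `j`-links at `(x_i, x_j) = (a + 1, b)` (between the stacks at `(a, b)` and `(a + 1, b)`). -/
def jLinksAt (i j : Fin d) (a : ZMod (Ls i)) (b : ZMod (Ls j)) : Finset (RectEdge Ls) :=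
  univ.filter fun e => e.2 = j ∧ e.1 i = a + 1 ∧ e.1 j = b

/-- The `i`-links at `(x_i, x_j) = (a, b + 1)` (between the stacks at `(a, b)` and `(a, b + 1)`). -/
def iLinksAt (i j : Fin d) (a : ZMod (Ls i)) (b : ZMod (Ls j)) : Finset (RectEdge Ls) :=
  univ.filter fun e => e.2 = i ∧ e.1 i = a ∧ e.1 j = b + 1

/-- Membership in `jLinksAt` (plumbing). -/
private theorem mem_jLinksAt (i j : Fin d) (a : ZMod (Ls i)) (b : ZMod (Ls j)) (y : RectTorusSite Ls) (m : Fin d) :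
    (y, m) ∈ jLinksAt Ls i j a b ↔ m = j ∧ y i = a + 1 ∧ y j = b := by
  simp [jLinksAt]

/-- Membership in `iLinksAt` (plumbing). -/
private theorem mem_iLinksAt (i j : Fin d) (a : ZMod (Ls i)) (b : ZMod (Ls j)) (y : RectTorusSite Ls) (m : Fin d) :
    (y, m) ∈ iLinksAt Ls i j a b ↔ m = i ∧ y i = a ∧ y j = b + 1 := by
  simp [iLinksAt]

variable {i j : Fin d} (hij : i < j)

/-! ### Parallel stacks and the link sets between them -/

/-- The `(i, j)`-stack at transverse position `(a, b)`: all `(i, j)`-plaquettes with `x_i = a`, `x_j = b`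
(`rectVortexSheet Ls i j hij = stackAt Ls hij 0 0`). -/
def stackAt (a : ZMod (Ls i)) (b : ZMod (Ls j)) : Finset (RectPlaquette Ls) :=
  univ.filter fun p => p.2 = ⟨(i, j), hij⟩ ∧ p.1 i = a ∧ p.1 j = b

/-- Membership in a stack. -/
theorem mem_stackAt (a : ZMod (Ls i)) (b : ZMod (Ls j)) (p : RectPlaquette Ls) :
    p ∈ stackAt Ls hij a b ↔ p.2 = ⟨(i, j), hij⟩ ∧ p.1 i = a ∧ p.1 j = b := by
  simp [stackAt]

/-- The twist stack of `TwistCensusObjects` is the stack at `(0, 0)`. -/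
theorem rectVortexSheet_eq_stackAt : rectVortexSheet Ls i j hij = stackAt Ls hij 0 0 := rfl

/-- `𝟙_P + 𝟙_Q` is odd iff exactly one of `P`, `Q` holds (plumbing). -/
private theorem odd_ite_add_ite'' (P Q : Prop) [Decidable P] [Decidable Q] :
    Odd ((if P then 1 else 0) + (if Q then 1 else 0) : ℕ) ↔ (P ∧ ¬Q ∨ Q ∧ ¬P) := by
  by_cases hP : P <;> by_cases hQ : Q <;> simp [hP, hQ, Nat.odd_iff]

/-- `𝟙_P + 𝟙_P` is even (plumbing). -/
private theorem not_odd_ite_add_self'' (P : Prop) [Decidable P] :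
    ¬Odd ((if P then 1 else 0) + (if P then 1 else 0) : ℕ) := by
  by_cases hP : P <;> simp [hP, Nat.odd_iff]

/-- **Adjacent stacks in the `i` direction cobound**: `δ(jLinksAt a b) = stackAt a b ∆ stackAt (a+1) b`
(port of `TwistSheet.coboundary_sheetLinksAt`). -/
theorem rectCoboundary_jLinksAt (a : ZMod (Ls i)) (b : ZMod (Ls j)) :
    rectCoboundary (jLinksAt Ls i j a b) = stackAt Ls hij a b ∆ stackAt Ls hij (a + 1) b := by
  ext p
  rcases p with ⟨y, ⟨⟨a', b'⟩, hab⟩⟩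
  rw [mem_rectCoboundary, Finset.mem_symmDiff, mem_stackAt, mem_stackAt]
  simp only [rectFlipCount, rectLinkInd, mem_jLinksAt]
  by_cases hb : b' = j
  · subst hb
    by_cases ha : a' = i
    · subst ha
      have h1 : (y + Pi.single a' 1 : RectTorusSite Ls) a' = y a' + 1 := by simp
      have h2 : (y + Pi.single a' 1 : RectTorusSite Ls) b' = y b' := by simp [Pi.single_eq_of_ne hij.ne']
      simp only [h1, h2, hij.ne, false_and, if_false, zero_add, add_zero, add_left_inj, true_and]
      exact odd_ite_add_ite'' _ _
    · have hne : ¬((⟨(a', b'), hab⟩ : {p : Fin d × Fin d // p.1 < p.2}) = ⟨(i, b'), hij⟩) := by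
        intro h
        exact ha (congrArg (fun q : {p : Fin d × Fin d // p.1 < p.2} => q.1.1) h)
      have h1 : (y + Pi.single a' 1 : RectTorusSite Ls) i = y i := by simp [Pi.single_eq_of_ne (Ne.symm ha)]
      have h2 : (y + Pi.single a' 1 : RectTorusSite Ls) b' = y b' := by simp [Pi.single_eq_of_ne hab.ne']
      simp only [h1, h2, hab.ne, hne, false_and, if_false, zero_add, add_zero, true_and, not_false_iff,
        and_true, or_self, iff_false]
      exact not_odd_ite_add_self'' _
  · by_cases ha : a' = j
    · subst ha
      have hne : ¬((⟨(a', b'), hab⟩ : {p : Fin d × Fin d // p.1 < p.2}) = ⟨(i, a'), hij⟩) := by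
        intro h
        exact hb (congrArg (fun q : {p : Fin d × Fin d // p.1 < p.2} => q.1.2) h)
      have h1 : (y + Pi.single b' 1 : RectTorusSite Ls) i = y i := by
        simp [Pi.single_eq_of_ne (hij.trans hab).ne]
      have h2 : (y + Pi.single b' 1 : RectTorusSite Ls) a' = y a' := by simp [Pi.single_eq_of_ne hab.ne]
      simp only [h1, h2, hb, hne, false_and, if_false, add_zero, true_and, not_false_iff,
        and_true, or_self, iff_false]
      exact not_odd_ite_add_self'' _
    · have hne : ¬((⟨(a', b'), hab⟩ : {p : Fin d × Fin d // p.1 < p.2}) = ⟨(i, j), hij⟩) := by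
        intro h
        exact hb (congrArg (fun q : {p : Fin d × Fin d // p.1 < p.2} => q.1.2) h)
      simp [ha, hb, hne]

/-- **Adjacent stacks in the `j` direction cobound**: `δ(iLinksAt a b) = stackAt a b ∆ stackAt a (b+1)`. -/
theorem rectCoboundary_iLinksAt (a : ZMod (Ls i)) (b : ZMod (Ls j)) :
    rectCoboundary (iLinksAt Ls i j a b) = stackAt Ls hij a b ∆ stackAt Ls hij a (b + 1) := by
  ext p
  rcases p with ⟨y, ⟨⟨a', b'⟩, hab⟩⟩
  rw [mem_rectCoboundary, Finset.mem_symmDiff, mem_stackAt, mem_stackAt]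
  simp only [rectFlipCount, rectLinkInd, mem_iLinksAt]
  by_cases ha : a' = i
  · subst ha
    by_cases hb : b' = j
    · subst hb
      have h1 : (y + Pi.single b' 1 : RectTorusSite Ls) b' = y b' + 1 := by simp
      have h2 : (y + Pi.single b' 1 : RectTorusSite Ls) a' = y a' := by simp [Pi.single_eq_of_ne hij.ne]
      simp only [h1, h2, hij.ne', false_and, if_false, add_zero, add_left_inj, true_and]
      rw [odd_ite_add_ite'']
      tauto
    · have hne : ¬((⟨(a', b'), hab⟩ : {p : Fin d × Fin d // p.1 < p.2}) = ⟨(a', j), hij⟩) := by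
        intro h
        exact hb (congrArg (fun q : {p : Fin d × Fin d // p.1 < p.2} => q.1.2) h)
      have h1 : (y + Pi.single b' 1 : RectTorusSite Ls) a' = y a' := by simp [Pi.single_eq_of_ne hab.ne]
      have h2 : (y + Pi.single b' 1 : RectTorusSite Ls) j = y j := by simp [Pi.single_eq_of_ne (Ne.symm hb)]
      simp only [h1, h2, hab.ne', hne, false_and, if_false, add_zero, true_and, not_false_iff,
        and_true, or_self, iff_false]
      exact not_odd_ite_add_self'' _
  · by_cases hb : b' = i
    · subst hb
      have hne : ¬((⟨(a', b'), hab⟩ : {p : Fin d × Fin d // p.1 < p.2}) = ⟨(b', j), hij⟩) := by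
        intro h
        exact ha (congrArg (fun q : {p : Fin d × Fin d // p.1 < p.2} => q.1.1) h)
      have h1 : (y + Pi.single a' 1 : RectTorusSite Ls) b' = y b' := by simp [Pi.single_eq_of_ne hab.ne']
      have h2 : (y + Pi.single a' 1 : RectTorusSite Ls) j = y j := by
        simp [Pi.single_eq_of_ne (hab.trans hij).ne']
      simp only [h1, h2, ha, hne, false_and, if_false, zero_add, true_and, not_false_iff,
        and_true, or_self, iff_false]
      exact not_odd_ite_add_self'' _
    · have hne : ¬((⟨(a', b'), hab⟩ : {p : Fin d × Fin d // p.1 < p.2}) = ⟨(i, j), hij⟩) := by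
        intro h
        exact ha (congrArg (fun q : {p : Fin d × Fin d // p.1 < p.2} => q.1.1) h)
      simp [ha, hb, hne]

/-! ### Parity transport: a contributing `S` meets all parallel stacks with the same parity -/

omit [∀ i, NeZero (Ls i)] in
/-- If `|S ∩ (A ∆ B)|` is even then `|S ∩ A|` and `|S ∩ B|` have the same parity (plumbing). -/
private theorem odd_inter_iff_of_even {α : Type*} [DecidableEq α] {S A B : Finset α}
    (h : Even (S ∩ (A ∆ B)).card) : Odd (S ∩ A).card ↔ Odd (S ∩ B).card := by
  have hsd : S ∩ (A ∆ B) = (S ∩ A) ∆ (S ∩ B) := by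
    ext p
    simp only [Finset.mem_inter, Finset.mem_symmDiff]
    tauto
  rw [hsd] at h
  have hunion : ((S ∩ A) ∆ (S ∩ B)).card = ((S ∩ A) \ (S ∩ B)).card + ((S ∩ B) \ (S ∩ A)).card := by
    rw [symmDiff_def, Finset.sup_eq_union]
    exact (Finset.card_union_eq_card_add_card).mpr disjoint_sdiff_sdiff
  have hX : ((S ∩ A) \ (S ∩ B)).card + ((S ∩ A) ∩ (S ∩ B)).card = (S ∩ A).card :=
    Finset.card_sdiff_add_card_inter _ _
  have hY : ((S ∩ B) \ (S ∩ A)).card + ((S ∩ B) ∩ (S ∩ A)).card = (S ∩ B).card :=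
    Finset.card_sdiff_add_card_inter _ _
  rw [Finset.inter_comm (S ∩ B) (S ∩ A)] at hY
  rw [Nat.even_iff] at h
  rw [Nat.odd_iff, Nat.odd_iff]
  omega

/-- Stepping the stack in the `i` direction preserves the parity of `|S ∩ stack|` whenever `S` meets the coboundary
`δ(jLinksAt a b)` evenly (combinatorial core). -/
theorem odd_inter_stackAt_succ_fst {S : Finset (RectPlaquette Ls)} {a : ZMod (Ls i)} {b : ZMod (Ls j)}
    (h : Even (S ∩ rectCoboundary (jLinksAt Ls i j a b)).card) :
    Odd (S ∩ stackAt Ls hij a b).card ↔ Odd (S ∩ stackAt Ls hij (a + 1) b).card := by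
  rw [rectCoboundary_jLinksAt Ls hij] at h
  exact odd_inter_iff_of_even h

/-- Stepping the stack in the `j` direction preserves the parity of `|S ∩ stack|` whenever `S` meets the coboundary
`δ(iLinksAt a b)` evenly (combinatorial core). -/
theorem odd_inter_stackAt_succ_snd {S : Finset (RectPlaquette Ls)} {a : ZMod (Ls i)} {b : ZMod (Ls j)}
    (h : Even (S ∩ rectCoboundary (iLinksAt Ls i j a b)).card) :
    Odd (S ∩ stackAt Ls hij a b).card ↔ Odd (S ∩ stackAt Ls hij a (b + 1)).card := by
  rw [rectCoboundary_iLinksAt Ls hij] at h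
  exact odd_inter_iff_of_even h

/-- **Parity transport (combinatorial core)**: if `S` meets the coboundaries of all the step link sets `jLinksAt`,
`iLinksAt` evenly, then `|S ∩ stackAt a b| ≡ |S ∩ stackAt 0 0| (mod 2)` for all `(a, b)`. -/
theorem odd_inter_stackAt_iff_of_even {S : Finset (RectPlaquette Ls)}
    (hj : ∀ (a : ZMod (Ls i)) (b : ZMod (Ls j)), Even (S ∩ rectCoboundary (jLinksAt Ls i j a b)).card)
    (hi : ∀ (a : ZMod (Ls i)) (b : ZMod (Ls j)), Even (S ∩ rectCoboundary (iLinksAt Ls i j a b)).card)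
    (a : ZMod (Ls i)) (b : ZMod (Ls j)) :
    Odd (S ∩ stackAt Ls hij a b).card ↔ Odd (S ∩ stackAt Ls hij 0 0).card := by
  have hA : ∀ (n : ℕ) (b : ZMod (Ls j)),
      (Odd (S ∩ stackAt Ls hij (n : ZMod (Ls i)) b).card ↔ Odd (S ∩ stackAt Ls hij 0 b).card) := by
    intro n b
    induction n with
    | zero => simp
    | succ n ih => rw [Nat.cast_succ, ← odd_inter_stackAt_succ_fst Ls hij (hj _ _), ih]
  have hB : ∀ (n : ℕ), (Odd (S ∩ stackAt Ls hij 0 (n : ZMod (Ls j))).card ↔ Odd (S ∩ stackAt Ls hij 0 0).card) := by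
    intro n
    induction n with
    | zero => simp
    | succ n ih => rw [Nat.cast_succ, ← odd_inter_stackAt_succ_snd Ls hij (hi _ _), ih]
  rw [← ZMod.natCast_zmod_val a, hA, ← ZMod.natCast_zmod_val b, hB]

/-- **A contributing plaquette set meets every parallel stack with the same parity**: if `I(S) ≠ 0` then
`|S ∩ stackAt a b| ≡ |S ∩ stackAt 0 0| (mod 2)` for all `(a, b)` (support rule + parity transport). -/
theorem odd_inter_stackAt_iff {S : Finset (RectPlaquette Ls)} (hS : rectCharMoment Ls S ≠ 0)
    (a : ZMod (Ls i)) (b : ZMod (Ls j)) :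
    Odd (S ∩ stackAt Ls hij a b).card ↔ Odd (S ∩ stackAt Ls hij 0 0).card :=
  odd_inter_stackAt_iff_of_even Ls hij
    (fun a b => even_inter_rectCoboundary_of_rectCharMoment_ne_zero Ls hS (jLinksAt Ls i j a b))
    (fun a b => even_inter_rectCoboundary_of_rectCharMoment_ne_zero Ls hS (iLinksAt Ls i j a b)) a b

/-! ### Counting: an odd-meeting contributing `S` has at least `L_i L_j` plaquettes -/

/-- The plaquettes of the `(i, j)` plane. -/
def planePlaquettes : Finset (RectPlaquette Ls) := univ.filter fun p => p.2 = ⟨(i, j), hij⟩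

/-- The `(i, j)`-plaquettes of `S` split over the `L_i L_j` parallel stacks. -/
theorem card_inter_planePlaquettes_eq_sum (S : Finset (RectPlaquette Ls)) :
    (S ∩ planePlaquettes Ls hij).card = ∑ c : ZMod (Ls i) × ZMod (Ls j), (S ∩ stackAt Ls hij c.1 c.2).card := by
  rw [Finset.card_eq_sum_card_fiberwise (f := fun p : RectPlaquette Ls => (p.1 i, p.1 j))
    (t := (univ : Finset (ZMod (Ls i) × ZMod (Ls j)))) (fun x _ => by simp)]
  refine Finset.sum_congr rfl fun c _ => ?_
  congr 1
  ext p
  simp only [Finset.mem_filter, Finset.mem_inter, planePlaquettes, mem_stackAt, Finset.mem_univ, true_and,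
    Prod.ext_iff]
  tauto

/-- **Counting (combinatorial core)**: a plaquette set meeting the step coboundaries evenly and the twist stack
`𝒱_{ij}` oddly meets each of the `L_i L_j` disjoint parallel stacks an odd, hence positive, number of times, so it
has at least `L_i L_j` plaquettes. -/
theorem le_card_of_even_of_odd {S : Finset (RectPlaquette Ls)}
    (hj : ∀ (a : ZMod (Ls i)) (b : ZMod (Ls j)), Even (S ∩ rectCoboundary (jLinksAt Ls i j a b)).card)
    (hi : ∀ (a : ZMod (Ls i)) (b : ZMod (Ls j)), Even (S ∩ rectCoboundary (iLinksAt Ls i j a b)).card)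
    (hodd : Odd (S ∩ rectVortexSheet Ls i j hij).card) : Ls i * Ls j ≤ S.card := by
  rw [rectVortexSheet_eq_stackAt] at hodd
  have hall : ∀ c : ZMod (Ls i) × ZMod (Ls j), 1 ≤ (S ∩ stackAt Ls hij c.1 c.2).card := fun c =>
    ((odd_inter_stackAt_iff_of_even Ls hij hj hi c.1 c.2).mpr hodd).pos
  have hsum : Ls i * Ls j ≤ (S ∩ planePlaquettes Ls hij).card := by
    rw [card_inter_planePlaquettes_eq_sum]
    calc Ls i * Ls j = ∑ _c : ZMod (Ls i) × ZMod (Ls j), 1 := by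
          simp [Finset.card_univ, Fintype.card_prod, ZMod.card]
      _ ≤ _ := Finset.sum_le_sum fun c _ => hall c
  exact hsum.trans (Finset.card_le_card Finset.inter_subset_left)

/-- **If `|S| < L_i L_j` and `S` meets the twist stack `𝒱_{ij}` an odd number of times, then `I(S) = 0`**
(support rule + `le_card_of_even_of_odd`). -/
theorem rectCharMoment_eq_zero_of_card_lt_of_odd {S : Finset (RectPlaquette Ls)} (hcard : S.card < Ls i * Ls j)
    (hodd : Odd (S ∩ rectVortexSheet Ls i j hij).card) : rectCharMoment Ls S = 0 := by
  by_contra hS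
  have hle := le_card_of_even_of_odd Ls hij
    (fun a b => even_inter_rectCoboundary_of_rectCharMoment_ne_zero Ls hS (jLinksAt Ls i j a b))
    (fun a b => even_inter_rectCoboundary_of_rectCharMoment_ne_zero Ls hS (iLinksAt Ls i j a b)) hodd
  omega

/-! ### The census polynomial: vanishing below the germ, and the germ coefficient -/

/-- Coefficients of `D := Z⁻_{𝒱} − Z` below `L_i L_j` vanish. -/
theorem coeff_oneCharZtwPoly_sub_eq_zero {k : ℕ} (hk : k < Ls i * Ls j) :
    (oneCharZtwPoly Ls (rectVortexSheet Ls i j hij) - oneCharZPoly Ls).coeff k = 0 := by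
  rw [coeff_sub, oneCharZtwPoly_coeff, oneCharZPoly_coeff, ← Finset.sum_sub_distrib]
  refine Finset.sum_eq_zero fun S hS => ?_
  have hSk : S.card = k := (Finset.mem_filter.mp hS).2
  rcases Nat.even_or_odd (S ∩ rectVortexSheet Ls i j hij).card with he | ho
  · rw [he.neg_one_pow]; ring
  · rw [rectCharMoment_eq_zero_of_card_lt_of_odd Ls hij (hSk ▸ hk) ho]; ring

/-- `X^{L_iL_j} ∣ Z⁻_{𝒱} − Z`. -/
theorem X_pow_dvd_oneCharZtwPoly_sub :
    X ^ (Ls i * Ls j) ∣ (oneCharZtwPoly Ls (rectVortexSheet Ls i j hij) - oneCharZPoly Ls) :=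
  X_pow_dvd_iff.mpr fun _ hk => coeff_oneCharZtwPoly_sub_eq_zero Ls hij hk

/-- `N_V = D′·Z − D·Z′` with `D = Z⁻_V − Z` (the Wronskian is blind to the common part). -/
theorem twistCensusPoly_eq_sub (V : Finset (RectPlaquette Ls)) :
    twistCensusPoly Ls V = derivative (oneCharZtwPoly Ls V - oneCharZPoly Ls) * oneCharZPoly Ls -
      (oneCharZtwPoly Ls V - oneCharZPoly Ls) * derivative (oneCharZPoly Ls) := by
  unfold twistCensusPoly
  rw [derivative_sub]
  ring

/-- `X^{L_iL_j − 1} ∣ N_{ij}`. -/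
theorem X_pow_dvd_twistCensusPoly :
    X ^ (Ls i * Ls j - 1) ∣ twistCensusPoly Ls (rectVortexSheet Ls i j hij) := by
  obtain ⟨Q, hQ⟩ := X_pow_dvd_oneCharZtwPoly_sub Ls hij
  have hXP : (X : ℝ[X]) ^ (Ls i * Ls j - 1) ∣ X ^ (Ls i * Ls j) := pow_dvd_pow X (Nat.sub_le _ 1)
  rw [twistCensusPoly_eq_sub, hQ, derivative_mul, derivative_X_pow]
  refine dvd_sub (dvd_mul_of_dvd_left (dvd_add ?_ ?_) _) (dvd_mul_of_dvd_left (dvd_mul_of_dvd_left hXP _) _)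
  · exact dvd_mul_of_dvd_left (dvd_mul_left _ _) _
  · exact dvd_mul_of_dvd_left hXP _

/-- **The vanishing half of the germ law (G), a theorem**: `coeff_k N_{ij} = 0` for every `k + 1 < L_i L_j` — the first
conjunct of `Conjectures.TwistCensusParity.GermLaw`, for every rectangular torus and every plane. -/
theorem twistCensusPoly_coeff_eq_zero_of_lt {k : ℕ} (hk : k + 1 < Ls i * Ls j) :
    (twistCensusPoly Ls (rectVortexSheet Ls i j hij)).coeff k = 0 :=
  (X_pow_dvd_iff.mp (X_pow_dvd_twistCensusPoly Ls hij)) k (by omega)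

/-- **The sheet moment sum** `Σ_{|S| = L_iL_j, |S ∩ 𝒱_{ij}| odd} 2^{L_iL_j} I(S)` — the one Haar-moment quantity the
germ coefficient depends on (mechanism: `= L_ρ`, the number of flat `(i, j)`-sheets, each of moment `2^{−L_iL_j}`). -/
def sheetMomentSum : ℝ :=
  ∑ S ∈ ((univ : Finset (RectPlaquette Ls)).powerset).filter
      (fun S => S.card = Ls i * Ls j ∧ Odd (S ∩ rectVortexSheet Ls i j hij).card),
    (2 : ℝ) ^ (Ls i * Ls j) * rectCharMoment Ls S

/-- `coeff_{L_iL_j} (Z⁻_{𝒱} − Z) = −2 · sheetMomentSum`. -/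
theorem coeff_oneCharZtwPoly_sub_sheet :
    (oneCharZtwPoly Ls (rectVortexSheet Ls i j hij) - oneCharZPoly Ls).coeff (Ls i * Ls j) =
      -2 * sheetMomentSum Ls hij := by
  have hR : -2 * sheetMomentSum Ls hij =
      ∑ S ∈ ((univ : Finset (RectPlaquette Ls)).powerset).filter (fun S => S.card = Ls i * Ls j),
        (if Odd (S ∩ rectVortexSheet Ls i j hij).card then
          -2 * ((2 : ℝ) ^ (Ls i * Ls j) * rectCharMoment Ls S) else 0) := by
    rw [sheetMomentSum, ← Finset.filter_filter, Finset.sum_filter, Finset.mul_sum]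
    refine Finset.sum_congr rfl fun S _ => ?_
    split_ifs <;> ring
  rw [coeff_sub, oneCharZtwPoly_coeff, oneCharZPoly_coeff, ← Finset.sum_sub_distrib, hR]
  refine Finset.sum_congr rfl fun S hS => ?_
  have hSk : S.card = Ls i * Ls j := (Finset.mem_filter.mp hS).2
  rcases Nat.even_or_odd (S ∩ rectVortexSheet Ls i j hij).card with he | ho
  · rw [he.neg_one_pow, if_neg (Nat.not_odd_iff_even.mpr he)]; ring
  · rw [ho.neg_one_pow, if_pos ho, hSk]; ring

/-- `I(∅) = 1` (the product Haar measure is a probability measure). -/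
theorem rectCharMoment_empty : rectCharMoment Ls ∅ = 1 := by
  unfold rectCharMoment
  simp

/-- `coeff_0 Z = 1`. -/
theorem oneCharZPoly_coeff_zero : (oneCharZPoly Ls).coeff 0 = 1 := by
  rw [oneCharZPoly_coeff]
  have h : ((univ : Finset (RectPlaquette Ls)).powerset).filter (fun S => S.card = 0) = {∅} := by
    ext S
    simp
  rw [h, Finset.sum_singleton, Finset.card_empty, pow_zero, one_mul, rectCharMoment_empty]

/-- **The germ coefficient**: `coeff_{L_iL_j − 1} N_{ij} = −2 · (L_i L_j) · sheetMomentSum` — so the second conjunct of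
the germ law (G) («`= −2·L_iL_j·L_ρ`») is EQUIVALENT to `sheetMomentSum = L_ρ`. -/
theorem twistCensusPoly_coeff_germ :
    (twistCensusPoly Ls (rectVortexSheet Ls i j hij)).coeff (Ls i * Ls j - 1) =
      -2 * ((Ls i * Ls j : ℕ) : ℝ) * sheetMomentSum Ls hij := by
  obtain ⟨Q, hQ⟩ := X_pow_dvd_oneCharZtwPoly_sub Ls hij
  have hP1 : 1 ≤ Ls i * Ls j := Nat.one_le_iff_ne_zero.mpr (mul_ne_zero (NeZero.ne _) (NeZero.ne _))
  have hQ0 : Q.coeff 0 = -2 * sheetMomentSum Ls hij := by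
    have h := coeff_oneCharZtwPoly_sub_sheet Ls hij
    rw [hQ, coeff_X_pow_mul', if_pos le_rfl, Nat.sub_self] at h
    exact h
  rw [twistCensusPoly_eq_sub, hQ, derivative_mul, derivative_X_pow, add_mul, sub_eq_add_neg, coeff_add, coeff_add,
    coeff_neg]
  have t1 : (C ((Ls i * Ls j : ℕ) : ℝ) * X ^ (Ls i * Ls j - 1) * Q * oneCharZPoly Ls).coeff (Ls i * Ls j - 1) =
      ((Ls i * Ls j : ℕ) : ℝ) * (Q.coeff 0 * (oneCharZPoly Ls).coeff 0) := by
    rw [mul_assoc, mul_assoc, coeff_C_mul, coeff_X_pow_mul', if_pos le_rfl, Nat.sub_self, mul_coeff_zero]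
  have t2 : (X ^ (Ls i * Ls j) * derivative Q * oneCharZPoly Ls).coeff (Ls i * Ls j - 1) = 0 := by
    rw [mul_assoc, coeff_X_pow_mul', if_neg (by omega)]
  have t3 : (X ^ (Ls i * Ls j) * Q * derivative (oneCharZPoly Ls)).coeff (Ls i * Ls j - 1) = 0 := by
    rw [mul_assoc, coeff_X_pow_mul', if_neg (by omega)]
  rw [t1, t2, t3, hQ0, oneCharZPoly_coeff_zero]
  ring

end Summit.Ventures.YMGap.Census

end
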